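import Summits.QuantumFields.BalabanUV.T4Continuum.Spine.NE7.QLa
import Summits.QuantumFields.BalabanUV.T4Continuum.Spine.NE7.Targets

/-!
# Spine/NE7/QLaBudget — (QL-a) in the currency of row NE1′: the per-component shape, the component census, the ratio
# `a = b·Λ` (second-order budget `b = θ₁²` gives `a = L⁻² < 1`; first-order ∕ oscillation size `b = θ₁` gives `a = L > 1`),
# and the `t`-FREE form of the leaf `Core` on the layer where the large-field operation is weakly invisible

Cell `pub-balaban-gaps` (YM blitz Y1, track G2, seat `ne7`, generation 2); text of record `run/shared/lean/pub/pub-balaban-gaps/ne/NE7.md`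
v2 §4bis («where `t` enters; (QL-a) × NE1′ reconciliation») and §6 rows R8 ∕ R9 ∕ R21–R23.  Third `Spine/NE7/` file (after `Targets`
p339119 and `QLa` p339533).

WHY.  Generation 0 classified NE7 «IDEA-bound at exactly one named item (QL-a)» (`Spine.NE7.QLa`: the scale-`j` slice of the
`t`-discrepancy of ONE dressed run's field-independent step constants is `≤ vol·Ew·a^{K−j}`, `a < 1`), while row NE1′ of the same
table (`HOME/ne/NE1.md` §0) reads the dressed run as «WORK-bound … no new idea: the observable is UV-irrelevant, θ₁ = L^{1−d} per
level EXACT (`T4LoopPullback.theta1_exact`), variance budget per scale `L^{4n}·θ₁^{2n}·g² = L^{−2n}g²` … summable».  The two rows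
point at each other (NE1.md line 5: «IDEA-bound items … are elsewhere (NE7)»; NE7.md §7: the idea is a ONE-run dressed item).  This
file records, in the kernel, the arithmetic that makes them ONE item:
* WHERE `t` ENTERS (tree, node O2): a pure renormalisation step does not see a factor of the NEXT block average —
  `T4Spectator.isRT_mul_comp` (`IsRT avg (ρ·(g∘avg)) (ρ'·g)`), iterated `T4Spectator.integral_mul_eq_integral_mul_comp_iter`; with
  the large-field operation weakly invisible (`T4Spectator.RWeaklyInvisible`, NOT printed, equivalent to the chain hypothesis) the
  Wilson expectation of `e^{t·F∘avg^K}` IS `∫ρ_K e^{tF} ∕ ∫ρ_K` (`T4Spectator.expect_exp_comp_iter_eq`).  So `t` reaches the step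
  constants ONLY through the large-field operation `R` ([Balaban1989LargeFieldI] p. 176 (0.3): quotients of fibre integrals of the
  density, which contain the rider; tree node O3b `T4DressingDefect.dTerm`, «|D_t| ≤ |t|·δ TRUE for one basic step … NOT the size
  that the tube budgets consume at later scales — with oscillation sizes the per-cube sums diverge by L^{2(K−k)} per scale — that
  size is NE1′ (`T4FirstOrderSize`) and its symmetry half `T4AdInvariant`», its module docstring).  §3 below: on the weakly-invisible
  layer the leaf `Core` is a `t`-FREE density sandwich and (QL-a) is EMPTY (`Ew = 0`).
* THE RATIO (§1–§2): a per-component bound `|c_t(X) − c_0(X)| ≤ E·|X|·b^{K − sc X}` (the D-term of the component `X`, in whatever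
  per-unit-`j`-volume currency `b` the dressed format delivers) and the component census `Σ_{sc X = j} |X| ≤ Cw·vol·Λ^{K−j}`
  (`T4RecentScale.Multiplicity`; for a unit region in `d = 4` EVERY `j`-cube may be large-field in some history: `Λ = L⁴`, no
  good-class cap) give `Spine.NE7.QLa` with `a = b·Λ` (`qla_of_pt_multiplicity`).  In NE1′'s SECOND-order currency (conditional-mean
  suppression + squared cost, (TOB-k): `b = θ₁² = L^{−6}`) `a = L^{−2} < 1` (`rate_secondOrder_eq`, `rate_secondOrder_lt_one`) — the
  letter route 1's END needs; in the FIRST-order ∕ oscillation currency (`b = θ₁ = L^{−3}`, what `T4DressingDefect` proves per step)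
  `a = L > 1` (`rate_firstOrder_eq`, `one_lt_rate_firstOrder`) — (QL-a) FAILS as a letter.  Hence (QL-a) ⟺ «NE1′'s second-order
  size mechanism holds for the `t`-dependent normalisation constants of the `R`-operation ((0.3)/(0.5); components of size ≤ 100MR_k,
  p. 177 (i)) through the R-bookkeeping» — the SAME unprinted one-run item as row NE1′ (T4-O3.E-i′), read on field-independent
  constants; NE7 adds only §1's bookkeeping.

HONEST FRAMING.  Every declaration is [folklore] arithmetic ∕ measure theory over abstract ledgers and measures; `θ₁ = L^{1−d}` enters
§2 as the NUMBER `L⁻³` (its meaning is `T4LoopPullback.theta1_exact` + [Balaban1985Averaging] Prop. 5 (156) p. 42 per NE1.md, not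
used here); the second-order currency is row NE1′'s HYPOTHESIS (NOT IN PRINT: [Balaban1989LargeFieldII] p. 356 defers «loop variables,
averaged loop variables»; precedent for another model [Balaban] CMP 198∕199, unread in the cell), NOT asserted.  NE7 NOT proved; spine
0∕9; fixed finite T⁴ — NOT ℝ⁴, NOT infinite volume, NOT a mass gap, NOT Clay.  Census effect (NE7.md v2): (QL-a) re-booked as the
residue SHARED with NE1′ (one item, two rows), its IDEA-risk concentrated in one checkable sub-claim (first-order suppression for the
R-quotients' `t`-derivative); R8 corrected (on NODE O-lite `core` is `t`-free, (QL-a) empty).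
-/

noncomputable section

open MeasureTheory Finset
open scoped BigOperators

namespace Summit.QuantumFields.BalabanUV.T4Continuum.Spine.NE7

open Literature.MathematicalPhysics.QuantumFieldTheory.Balaban1983to89
open Literature.MathematicalPhysics.QuantumFieldTheory.Balaban1983to89.T4RecentScale (Multiplicity)

/-! ## §1 (QL-a) per component, and the component census: `a = b·Λ` -/

section Ratio

variable {D : Type*}

/-- [shape] **(QL-a) PER COMPONENT.**  On a ledger `wf` of (large-field) components with scales `sc` and volume weights `wt`
(`|X|` in scale-`sc X` cubes), the `t`-discrepancy of the field-independent constant of `X` is at most `E·wt X·b^{K − sc X}`: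
the component's D-term in a per-unit-volume currency `b` per remaining scale.  A definition of a proposition, NOT a fact; which
`b` a dressed format delivers is row NE1′'s business (second order: `b = θ₁²`; oscillation ∕ first order: `b = θ₁`). [folklore] -/
def QLaPt (wf : Finset D) (sc : D → ℕ) (wt ct c0 : D → ℝ) (K : ℕ) (E b : ℝ) : Prop :=
  ∀ X ∈ wf, |ct X - c0 X| ≤ E * wt X * b ^ (K - sc X)

/-- [bookkeeping] **PER-COMPONENT BOUND × COMPONENT CENSUS ⟹ (QL-a) WITH `a = b·Λ`.**  `QLaPt … E b` and the census
`T4RecentScale.Multiplicity wf sc wt Cw vol Λ K` (`Σ_{sc X = j} wt X ≤ Cw·vol·Λ^{K−j}`) give `Spine.NE7.QLa … vol (E·Cw) (b·Λ)`.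
Finite-sum algebra. [folklore] -/
theorem qla_of_pt_multiplicity {wf : Finset D} {sc : D → ℕ} {wt ct c0 : D → ℝ} {K : ℕ} {E b Cw vol Λ : ℝ}
    (hpt : QLaPt wf sc wt ct c0 K E b) (hM : Multiplicity wf sc wt Cw vol Λ K) (hE : 0 ≤ E) (hb : 0 ≤ b) :
    QLa wf sc ct c0 K vol (E * Cw) (b * Λ) := by
  intro j hj
  calc ∑ X ∈ wf with sc X = j, |ct X - c0 X|
      ≤ ∑ X ∈ wf with sc X = j, E * b ^ (K - j) * wt X := sum_le_sum fun X hX => by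
          obtain ⟨hXw, hXj⟩ := mem_filter.mp hX
          calc |ct X - c0 X| ≤ E * wt X * b ^ (K - sc X) := hpt X hXw
            _ = E * b ^ (K - j) * wt X := by rw [hXj]; ring
    _ = E * b ^ (K - j) * ∑ X ∈ wf with sc X = j, wt X := (mul_sum _ _ _).symm
    _ ≤ E * b ^ (K - j) * (Cw * vol * Λ ^ (K - j)) :=
        mul_le_mul_of_nonneg_left (hM j hj) (mul_nonneg hE (pow_nonneg hb _))
    _ = vol * (E * Cw * (b * Λ) ^ (K - j)) := by rw [mul_pow]; ring

/-- [bookkeeping] Conversely nothing is lost for ONE-component slices: if every scale carries at most one component of weight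
`≤ Cw·vol·Λ^{K − sc X}`, the census holds — recorded only to show the census is the (0.26)-type count and not an estimate.
[folklore] -/
theorem multiplicity_of_pointwise {wf : Finset D} {sc : D → ℕ} {wt : D → ℝ} {K : ℕ} {Cw vol Λ : ℝ}
    (hone : ∀ j ≤ K, (wf.filter fun X => sc X = j).card ≤ 1)
    (hwt : ∀ X ∈ wf, wt X ≤ Cw * vol * Λ ^ (K - sc X)) (hnn : 0 ≤ Cw * vol) (hΛ : 0 ≤ Λ) :
    Multiplicity wf sc wt Cw vol Λ K := by
  intro j hj
  rcases Nat.le_one_iff_eq_zero_or_eq_one.mp (hone j hj) with h0 | h1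
  · rw [Finset.card_eq_zero.mp h0, sum_empty]
    exact mul_nonneg hnn (pow_nonneg hΛ _)
  · obtain ⟨X, hX⟩ := Finset.card_eq_one.mp h1
    rw [hX, sum_singleton]
    have hXm : X ∈ wf.filter fun X => sc X = j := by rw [hX]; exact mem_singleton_self X
    obtain ⟨hXw, hXj⟩ := mem_filter.mp hXm
    rw [← hXj]
    exact hwt X hXw

end Ratio

/-! ## §2 The two currencies of row NE1′ in `d = 4`: second order gives `a = L⁻² < 1`, first order gives `a = L > 1` -/

section Currencies

/-- [bookkeeping] SECOND-ORDER CURRENCY: with the census rate `Λ = L⁴` of a unit region in `d = 4` and the per-unit-volume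
budget `b = θ₁² = (L⁻³)²` (NE1′'s (TOB-k): conditional-mean suppression + squared cost), the (QL-a) ratio is `a = b·Λ = L⁻²`.
[folklore] -/
theorem rate_secondOrder_eq {L : ℝ} (hL : L ≠ 0) : (L⁻¹ ^ 3) ^ 2 * L ^ 4 = L⁻¹ ^ 2 := by
  field_simp

/-- [bookkeeping] … and `a = L⁻² < 1` for `L > 1`: the letter `a < 1` that route 1's END (`TermwiseResidualWitness.tBracket_le`,
`T4Crossover.summable_sum_min_pow`) needs is MET in the second-order currency. [folklore] -/
theorem rate_secondOrder_lt_one {L : ℝ} (hL : 1 < L) : (L⁻¹ ^ 3) ^ 2 * L ^ 4 < 1 := by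
  rw [rate_secondOrder_eq (by positivity)]
  have h : L⁻¹ < 1 := inv_lt_one_of_one_lt₀ hL
  have h0 : 0 ≤ L⁻¹ := inv_nonneg.mpr (by positivity)
  calc L⁻¹ ^ 2 < 1 ^ 2 := pow_lt_pow_left₀ h h0 two_ne_zero
    _ = 1 := one_pow 2

/-- [bookkeeping] FIRST-ORDER (OSCILLATION) CURRENCY: with `b = θ₁ = L⁻³` (the TRUE one-step D-term size of `T4DressingDefect`)
the ratio is `a = b·Λ = L`. [folklore] -/
theorem rate_firstOrder_eq {L : ℝ} (hL : L ≠ 0) : L⁻¹ ^ 3 * L ^ 4 = L := by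
  field_simp

/-- [bookkeeping] … and `a = L > 1`: in the first-order currency (QL-a) FAILS as a letter (the slice bound `vol·Ew·L^{K−j}` GROWS with
the age) — the kernel form of the cell's remark «with oscillation sizes the per-cube sums diverge» (`T4DressingDefect` docstring,
T4-REF-O3 V3) and the reason (QL-a) needs NE1′'s second-order mechanism for the `R`-quotients. [folklore] -/
theorem one_lt_rate_firstOrder {L : ℝ} (hL : 1 < L) : 1 < L⁻¹ ^ 3 * L ^ 4 := by
  rw [rate_firstOrder_eq (by positivity)]
  exact hL

variable {D : Type*}

/-- [bookkeeping] **(QL-a) IN NE1′'s SECOND-ORDER CURRENCY**: a per-component second-order bound (`b = (L⁻³)²`) and the unit-region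
census (`Λ = L⁴`) give `Spine.NE7.QLa` with `a = L⁻²` — for `L > 1` a ratio `< 1`.  CONDITIONAL on both hypotheses; the first is row
NE1′'s unprinted content read on field-independent constants, the second the (0.26)-type count. [folklore] -/
theorem qla_secondOrder {wf : Finset D} {sc : D → ℕ} {wt ct c0 : D → ℝ} {K : ℕ} {E Cw vol L : ℝ} (hL : L ≠ 0) (hE : 0 ≤ E)
    (hpt : QLaPt wf sc wt ct c0 K E ((L⁻¹ ^ 3) ^ 2)) (hM : Multiplicity wf sc wt Cw vol (L ^ 4) K) :
    QLa wf sc ct c0 K vol (E * Cw) (L⁻¹ ^ 2) := by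
  rw [← rate_secondOrder_eq hL]
  exact qla_of_pt_multiplicity hpt hM hE (by positivity)

end Currencies

/-! ## §3 On the weakly-invisible layer the leaf `Core` is `t`-FREE and (QL-a) is empty -/

section TFree

variable {ι : Type*} [DecidableEq ι] {l₀ vol : ℝ} {T : ℕ → Finset ι} {δ : ℕ → ℝ}

/-- [folklore] **`Core` FROM A `t`-FREE SANDWICH.**  If the two runs' (shell-free) history weights are rider-integrals of `t`-FREE
densities on a common space per `K` — `P K t τ = ∫ e^{t·F_K}·a_{K,τ} dμ_K`, `Q K t τ = ∫ e^{t·F_K}·b_{K,τ} dμ_K` (the layer of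
`T4Spectator.expect_exp_comp_iter_eq`: `R` weakly invisible, `F_K` the unit-scale observable, `a`, `b` the two runs' unit-lattice
history densities) — and the densities match POINTWISE modulo one constant per `K` on a `t`-free good class, then
`Spine.NE7.Core` holds for every `t` at once (the rider is positive, the integral monotone).  On that layer NE7's `core` is the
TEMPLATE [King1986] Thm 3.4 ∕ (3.10)–(3.13) — a matching of effective DENSITIES modulo constants — with no `t`-analysis; the node's
exit is then `T4CauchySum.matchingModConstants_of_densities`' business.  NODE O-lite (NE7.md R8) is such a layer. [folklore] -/
theorem core_of_tFreeSandwich {Ω : ℕ → Type*} [∀ K, MeasurableSpace (Ω K)] (μ : (K : ℕ) → Measure (Ω K))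
    (F : (K : ℕ) → Ω K → ℝ) (a b : (K : ℕ) → ι → Ω K → ℝ) (Bad₀ : ℕ → Finset ι) {P Q : ℕ → ℝ → ι → ℝ}
    (hP : ∀ K t τ, P K t τ = ∫ x, Real.exp (t * F K x) * a K τ x ∂μ K)
    (hQ : ∀ K t τ, Q K t τ = ∫ x, Real.exp (t * F K x) * b K τ x ∂μ K)
    (hia : ∀ K t τ, Integrable (fun x => Real.exp (t * F K x) * a K τ x) (μ K))
    (hib : ∀ K t τ, Integrable (fun x => Real.exp (t * F K x) * b K τ x) (μ K))
    (hsand : ∀ K, ∃ c : ℝ, ∀ τ ∈ T K \ Bad₀ K, ∀ x,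
      Real.exp (c - vol * δ K) * a K τ x ≤ b K τ x ∧ b K τ x ≤ Real.exp (c + vol * δ K) * a K τ x) :
    Core l₀ vol T (fun K _ => Bad₀ K) P Q δ := by
  intro K
  obtain ⟨c, hc⟩ := hsand K
  refine ⟨c, fun t _ τ hτ => ?_⟩
  have hlo : ∀ x, Real.exp (c - vol * δ K) * (Real.exp (t * F K x) * a K τ x) ≤ Real.exp (t * F K x) * b K τ x :=
    fun x => by
      have := mul_le_mul_of_nonneg_left (hc τ hτ x).1 (Real.exp_pos (t * F K x)).le
      linarith [this, mul_left_comm (Real.exp (t * F K x)) (Real.exp (c - vol * δ K)) (a K τ x)]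
  have hhi : ∀ x, Real.exp (t * F K x) * b K τ x ≤ Real.exp (c + vol * δ K) * (Real.exp (t * F K x) * a K τ x) :=
    fun x => by
      have := mul_le_mul_of_nonneg_left (hc τ hτ x).2 (Real.exp_pos (t * F K x)).le
      linarith [this, mul_left_comm (Real.exp (t * F K x)) (Real.exp (c + vol * δ K)) (a K τ x)]
  rw [hP, hQ]
  constructor
  · rw [← integral_const_mul]
    exact integral_mono ((hia K t τ).const_mul _) (hib K t τ) hlo
  · rw [← integral_const_mul]
    exact integral_mono (hib K t τ) ((hia K t τ).const_mul _) hhi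

/-- [bookkeeping] … and on such a layer the one-run item (QL-a) holds with `Ew = 0`: a weakly-invisible dressed run's step constants
ARE the undressed ones (`T4Spectator.isRT_mul_comp` level by level), so `ct = c0` and `Spine.NE7.QLa` is `qla_of_blind`.  The kernel
name for the census line «(QL-a) is EMPTY on NODE O-lite». [folklore] -/
theorem qla_tBlind {D : Type*} {wf : Finset D} {sc : D → ℕ} {c0 : D → ℝ} {K : ℕ} {vol a : ℝ} :
    QLa wf sc c0 c0 K vol 0 a :=
  qla_of_blind fun _ _ => rfl

end TFree

/-! ## §4 Sanity: the shapes are jointly inhabited and the lemmas fire -/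

section Sanity

/-- SANITY: one component of scale `0`, weight `1`, discrepancy `E·b^K`; census constant `Cw = 1`, `vol = 1`; §1 gives `QLa` with
`a = b·Λ`. [folklore] -/
example (K : ℕ) (E b Λ : ℝ) (hE : 0 ≤ E) (hb : 0 ≤ b) (hΛ : 1 ≤ Λ) :
    QLa ({()} : Finset Unit) (fun _ => 0) (fun _ => E * b ^ K) (fun _ => 0) K 1 (E * 1) (b * Λ) := by
  refine qla_of_pt_multiplicity (wt := fun _ => 1) (fun X _ => ?_) (fun j _ => ?_) hE hb
  · simp [abs_of_nonneg (mul_nonneg hE (pow_nonneg hb K))]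
  · calc ∑ X ∈ ({()} : Finset Unit) with (fun _ : Unit => 0) X = j, (fun _ : Unit => (1 : ℝ)) X
        ≤ ∑ X ∈ ({()} : Finset Unit), (fun _ : Unit => (1 : ℝ)) X :=
          sum_le_sum_of_subset_of_nonneg (filter_subset _ _) fun _ _ _ => zero_le_one
      _ = 1 := by simp
      _ ≤ 1 * 1 * Λ ^ (K - j) := by rw [one_mul, one_mul]; exact one_le_pow₀ hΛ

/-- SANITY (non-degenerate instance of §3): constant densities `a = 1`, `b = e^{c}` on a one-point space match with `δ = 0`, and
`Core` fires with Bad = ∅ for every `t`. [folklore] -/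
example (T : ℕ → Finset ℕ) (c : ℝ) :
    Core 1 1 T (fun _ _ => ∅)
      (fun _ t _ => ∫ x, Real.exp (t * (0 : Unit → ℝ) x) * (1 : ℝ) ∂(Measure.dirac ()))
      (fun _ t _ => ∫ x, Real.exp (t * (0 : Unit → ℝ) x) * Real.exp c ∂(Measure.dirac ())) (fun _ => 0) :=
  core_of_tFreeSandwich (ι := ℕ) (fun _ => Measure.dirac ()) (fun _ => 0) (fun _ _ _ => 1) (fun _ _ _ => Real.exp c)
    (fun _ => ∅) (fun _ _ _ => rfl) (fun _ _ _ => rfl) (fun _ _ _ => Integrable.of_finite)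
    (fun _ _ _ => Integrable.of_finite) fun _ => ⟨c, fun τ _ x => by simp⟩

/-- SANITY (the numbers of §2 at `L = 2`): second order `a = 1∕4`, first order `a = 2`. [folklore] -/
example : ((2 : ℝ)⁻¹ ^ 3) ^ 2 * 2 ^ 4 = 1 / 4 ∧ (2 : ℝ)⁻¹ ^ 3 * 2 ^ 4 = 2 := by norm_num

end Sanity

end Summit.QuantumFields.BalabanUV.T4Continuum.Spine.NE7

end
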